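import Summits.AtomisticToContinuum.FouriersLaw.Theses.CoercivePulse

/-!
# Birth skeleton (BC3) of crux `CoercivePulse.AbelRegularity` (stmt-AtomisticToContinuum-15384)
# — line `birth`: CURRENT SPECTRAL MEASURE + ZERO-FREQUENCY SYMMETRIC DERIVATIVE + FATOU'S RADIAL LEMMA

Crux (route `route-AtomisticToContinuum-CoercivePulse`, rank 4; shared verbatim with
`route-AtomisticToContinuum-HoelderEscapeProfile`, rank 5 — one item, text identical; sub-problem `FouriersLaw`;
registrar `planner-skel-stmt-AtomisticToContinuum-15384-0`, 2026-08-17). FIXED, concluded BY NAME below: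

  `AbelRegularity` — for `pinnedChain ω₂ lam β γ` (`ω₂, lam, β > 0`, any `γ`), every `T > 0`, every shift- and
  momentum-reversal-invariant DLR Gibbs state `μ` and every `μ`-preserving, a.e. shift-covariant infinite-volume
  dynamics `D`: if the summed current correlations `C_T(t) = D.currentCorrelation μ t` converge absolutely at every
  `t` and `e^{−νt} C_T ∈ L¹(0,∞)` for every `ν > 0`, then the Abel means `A(ν) = ∫₀^∞ e^{−νt} C_T(t) dt` converge in
  `ℝ` as `ν ↓ 0` OR tend to `+∞` — only oscillation is forbidden.

## The line (the route's own two-layer plan "AbelRegularity ⇐ SpectralSymmetricDerivative by the Poisson-kernel /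
layer-cake lemma", typed and cut into three named stubs)

Spectral reading: `C_T` is of positive type (stationarity of `(μ, φ_t)`, shift invariance + a.e. shift covariance
and absolute summability make `C_T(t) = lim_N (2N+1)⁻¹ ⟨J_N, J_N ∘ φ_t⟩_μ`, `J_N = Σ_{|x|≤N} j_x`), hence the cosine
transform of a finite positive measure `ρ` on `ℝ` (the CURRENT SPECTRAL MEASURE at `T`), and then, by Fubini,
`A(ν) = ∫ ν/(ν²+ω²) dρ(ω)` = `π ×` the Poisson integral of `ρ` at the point `iν` of the upper half plane.
So `AbelRegularity` is the statement that the positive harmonic function `P[ρ]` has a NORMAL boundary limit in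
`[0, ∞]` at the origin, and Fatou's theorem (1906; layer cake against the kernel `4νr²/(ν²+r²)²` of mass `π`) says
this holds as soon as `ρ` has a SYMMETRIC DERIVATIVE `lim_{ε↓0} ρ[−ε, ε]/(2ε) ∈ [0, ∞]` at `0`.

* `stub_spectralStieltjes` (S1, size M–L, true-in-kind: Stone–Bochner for the Koopman group of `(μ, φ_t)` on the
  cyclic vector "total current", thermodynamic normalisation, Fubini): under the crux hypotheses there is a finite
  measure `ρ` on `ℝ` with `A(ν) = ∫ ν/(ν²+ω²) dρ(ω)` for every `ν > 0`.
* `stub_zeroFrequencySymmetricDerivative` (S2, the load-bearing PHYSICS stub, OPEN — the former draft crux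
  `SpectralSymmetricDerivative` stmt-AtomisticToContinuum-15157, re-typed over the representing measure): for every
  finite `ρ` representing `A` as in S1 (such a `ρ` is unique up to symmetrisation: Stieltjes inversion), the
  symmetric averages `ρ[−ε, ε]/(2ε)` converge in `ℝ` or tend to `+∞` as `ε ↓ 0`.
* `stub_fatouRadialPoisson` (S3, size M, classical real analysis, no chain in it): for every finite measure `ρ`
  on `ℝ`, symmetric derivative `L` at `0` ⇒ `∫ ν/(ν²+ω²) dρ → πL` as `ν ↓ 0`; symmetric derivative `+∞` ⇒ `→ +∞`.

COMPOSITION (sorry-free, `AbelRegularity_of`): S1 gives `ρ`; S2 the dichotomy for `ρ`; S3 turns either branch into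
the corresponding branch for `ν ↦ ∫ ν/(ν²+ω²) dρ`, which agrees with `A` on `(0, ∞)` ∋ eventually every `ν` of
`𝓝[>] 0` (`Tendsto.congr'`). Why the cut is not a costume: S1 is true for every stationary `L²` process (no
transport content), S3 is a theorem of harmonic analysis, and neither gives the crux alone (the Poisson integral
of a finite measure CAN oscillate radially: lacunary dyadic mass); S2 alone does not type the Abel means at all.
Conversely the crux gives S2 back only through Loomis' converse of Fatou's theorem for POSITIVE measures
(Loomis 1943, Trans. AMS 53) — a genuine Tauberian theorem, not a rewording — so S2 is the honest TRANSFER of the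
crux to the spectral side, where it is EASIER in the sense that it exposes the object the sub-problem's spectral
engines act on: a limiting-absorption / Mourre estimate for the Liouvillean on the current vector near frequency
`0` (route EmbeddedDrudeMourre) gives a density continuous at `0` (finite `L`); a Drude atom `ρ{0} > 0` (hidden
conserved charge, Mazur 1969; the harmonic member) gives `+∞`; an eventual sign of `C_T` makes `A` eventually
monotone. What S2 must exclude is exactly the crux's recorded failure mode (lacunary / log-periodic spectral mass
at `ω = 0`), now stated on `ρ` where positivity and kinetic (`lam T → 0`) asymptotics can be brought to bear.

BC3 probes (planner folder `bc/stub_*_probe.lean`, importing only the route file; battery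
`first | exact? | simpa [Stub] | (unfold Stub; simpa) | aesop`, `maxHeartbeats 400000`): `stub → AbelRegularity`
and `stub → FouriersLaw` FAIL for all three stubs (rc / messages quoted in `Lines/birth.md`).
Disproof used: none on file (`ledger crux ls stmt-AtomisticToContinuum-15384`: no `Disproof.lean`, no `Negative/`
lemma, 2026-08-17). Negatives index (`ledger negatives --problem AtomisticToContinuum`, 20 entries): the two
FouriersLaw refutations (`not_OddCorrectorDecay` stmt-9139, `DiluteCellGaussianiserFarFieldGaussianity_refuted`
stmt-12890) concern other objects; no stub is an instance of a refuted statement.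
Leans on (by name, for the provers): `Literature.Analysis.FunctionSpaces.IsPositiveDefinite.exists_isFiniteMeasure_charFun_eq`
(Bochner for finite measures, PROVED in tree), `Literature.Analysis.UnboundedOperators.UnitaryRep…exists_spectralMeasure` /
`matrixCoeff_eq_integral_spectralMeasure` (Stone–Bochner, PROVED), Mathlib `MeasureTheory.lintegral_eq_lintegral_meas_lt`
-type layer-cake lemmas and `integral_exp_mul_Ioi`-type Laplace integrals (S1/S3); the Abelian/Tauberian neighbours
`Literature.Analysis.Asymptotics.Widder1941_abelian_laplace_holds`, `karamata_tauberian_laplace_two` are NOT used.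

Registered stubs (3): `stub_spectralStieltjes`, `stub_zeroFrequencySymmetricDerivative`, `stub_fatouRadialPoisson` —
each a sorried theorem `Holds.stub_<name> : <full statement over tree declarations> := by sorry` (registered by
`ledger skeleton check` under the short name with THAT text as signature) plus the by-name handle
`def stub_<name> : Prop := type_of% Holds.stub_<name>` required of the hypotheses of `AbelRegularity_of` by the
layer-invariant audit (`#h21_check_skeleton`; device of `Cruxes/BoundedResponse/Lines/birth.lean`).
Skeleton theorem: `AbelRegularity_of : stub_spectralStieltjes → stub_zeroFrequencySymmetricDerivative →
stub_fatouRadialPoisson → CoercivePulse.AbelRegularity` (sorry-free; axioms propext / Classical.choice / Quot.sound).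
The twin `HoelderEscapeProfile.AbelRegularity` has the identical text (shared item) and follows by the same term;
it is not rendered here so that the import cone stays at the one Theses file actually used.
-/

noncomputable section

namespace Summit.AtomisticToContinuum.FouriersLaw.Cruxes.AbelRegularity.Birth

open Filter Topology MeasureTheory

/-! ## Part I — registered stubs (the lemmas of the line; `sorry` only here) -/

/-- **Stub S1 — `spectralStieltjes`: the Abel means are the Poisson–Stieltjes transform of a finite positive
measure (the current spectral measure).** Under the crux hypotheses (Gibbs `μ`, shift- and momentum-reversal
invariant; `μ`-preserving a.e. shift-covariant dynamics `D`; absolutely convergent summed current correlations at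
every `t`; `e^{−νt}C_T ∈ L¹(0,∞)` for all `ν > 0`) there is a finite Borel measure `ρ` on `ℝ` with
`∫₀^∞ e^{−νt} C_T(t) dt = ∫ ν/(ν²+ω²) dρ(ω)` for every `ν > 0`.
Why plausibly true: `C_T(t) = lim_N (2N+1)⁻¹⟨J_N, U_t J_N⟩` pointwise (absolute summability controls the
`|z|/(2N+1)` boundary weights by dominated convergence), each `t ↦ ⟨J_N, U_t J_N⟩` is positive definite for the
Koopman group `U_t` of the measure-preserving flow, positive type passes to pointwise limits, and a measurable
locally integrable function of positive type is a.e. the Fourier(-cosine, `C_T` is real and even) transform of a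
finite positive measure (Bochner–Riesz; in tree: `IsPositiveDefinite.exists_isFiniteMeasure_charFun_eq`,
`UnitaryRep` spectral measures); Fubini with `∫₀^∞ e^{−νt}cos(ωt)dt = ν/(ν²+ω²)`. Why it might fail AS TYPED:
strong continuity of the Koopman group needs joint measurability of `(t,σ) ↦ φ_t σ` (orbits are `C¹`, each `φ_t`
measurable — a Carathéodory argument, not a field of `InfiniteChainDynamics`). Size M–L. -/
theorem Holds.stub_spectralStieltjes :
    ∀ ω₂ lam β γ : ℝ, 0 < ω₂ → 0 < lam → 0 < β → ∀ T : ℝ, 0 < T → ∀ μ : MeasureTheory.Measure Literature.MathematicalPhysics.KineticTheory.HeatConduction.ChainConfig, (Literature.MathematicalPhysics.KineticTheory.HeatConduction.pinnedChain ω₂ lam β γ).IsChainGibbsMeasure T μ → Literature.MathematicalPhysics.KineticTheory.HeatConduction.IsShiftInvariant μ → μ.map (fun σ : Literature.MathematicalPhysics.KineticTheory.HeatConduction.ChainConfig => fun x : ℤ => ((σ x).1, -(σ x).2)) = μ → ∀ D : Literature.MathematicalPhysics.KineticTheory.HeatConduction.InfiniteChainDynamics (Literature.MathematicalPhysics.KineticTheory.HeatConduction.pinnedChain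 ω₂ lam β γ), D.PreservesMeasure μ → (∀ t : ℝ, ∀ᵐ σ ∂μ, D.flow t (Literature.MathematicalPhysics.KineticTheory.HeatConduction.shift σ) = Literature.MathematicalPhysics.KineticTheory.HeatConduction.shift (D.flow t σ)) → (∀ t : ℝ, D.HasAbsConvergentCorrelation μ t) → (∀ ν : ℝ, 0 < ν → MeasureTheory.IntegrableOn (fun t : ℝ => Real.exp (-(ν * t)) * D.currentCorrelation μ t) (Set.Ioi 0)) → ∃ ρ : MeasureTheory.Measure ℝ, MeasureTheory.IsFiniteMeasure ρ ∧ ∀ ν : ℝ, 0 < ν → ∫ t in Set.Ioi (0:ℝ), Real.exp (-(ν * t)) * D.currentCorrelation μ t = ∫ ω, ν / (ν ^ 2 + ω ^ 2) ∂ρ := by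
  sorry

/-- **Stub S2 — `zeroFrequencySymmetricDerivative`: the current spectral measure has a symmetric derivative at
frequency `0`, finite or `+∞` (the load-bearing PHYSICS stub; OPEN).** Under the crux hypotheses, for every finite
measure `ρ` on `ℝ` with `A(ν) = ∫ ν/(ν²+ω²) dρ(ω)` for all `ν > 0` (unique up to symmetrisation, so this is a
statement about THE current spectral measure), `ρ[−ε, ε]/(2ε)` converges in `ℝ` or tends to `+∞` as `ε ↓ 0`.
This is the former draft crux `SpectralSymmetricDerivative` (stmt-AtomisticToContinuum-15157, grounded OPEN, dropped
from the route in favour of the weaker `AbelRegularity` it implies) typed over the representing measure.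
Why plausibly true: expected whenever the low-frequency current spectrum is governed by ONE mechanism — a density
continuous at `0` (diffusive, `κ_GK = π⁻¹·` density, finite `L`; what a Mourre / limiting-absorption estimate on
the current vector gives), a Drude atom `ρ{0} > 0` (ballistic, `+∞`), or any regularly varying `ρ[−ε,ε]`.
Why it might fail: lacunary / log-periodic spectral mass at `ω = 0` (alternating power laws on dyadic shells)
makes the symmetric averages oscillate, and nothing known for a deterministic anharmonic chain excludes it — the
zero-frequency regularity question (BonettoLebowitzReyBellet2000 §7; Spohn 1991 II.§8). By Loomis' converse of
Fatou's theorem (positive measures) S2 is implied back by the crux, i.e. it is the crux's honest spectral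
transfer, not a strengthening by much. Size L–XL. -/
theorem Holds.stub_zeroFrequencySymmetricDerivative :
    ∀ ω₂ lam β γ : ℝ, 0 < ω₂ → 0 < lam → 0 < β → ∀ T : ℝ, 0 < T → ∀ μ : MeasureTheory.Measure Literature.MathematicalPhysics.KineticTheory.HeatConduction.ChainConfig, (Literature.MathematicalPhysics.KineticTheory.HeatConduction.pinnedChain ω₂ lam β γ).IsChainGibbsMeasure T μ → Literature.MathematicalPhysics.KineticTheory.HeatConduction.IsShiftInvariant μ → μ.map (fun σ : Literature.MathematicalPhysics.KineticTheory.HeatConduction.ChainConfig => fun x : ℤ => ((σ x).1, -(σ x).2)) = μ → ∀ D : Literature.MathematicalPhysics.KineticTheory.HeatConduction.InfiniteChainDynamics (Literature.MathematicalPhysics.KineticTheory.HeatConduction.pinnedChain ω₂ lam β γ), D.PreservesMeasure μ → (∀ t : ℝ, ∀ᵐ σ ∂μ, D.flow t (Literature.MathematicalPhysics.KineticTheory.HeatConduction.shift σ) = Literature.MathematicalPhysics.KineticTheory.HeatConduction.shift (D.flow t σ)) → (∀ t : ℝ, D.HasAbsConvergentCorrelation μ t) → (∀ ν : ℝ, 0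 < ν → MeasureTheory.IntegrableOn (fun t : ℝ => Real.exp (-(ν * t)) * D.currentCorrelation μ t) (Set.Ioi 0)) → ∀ ρ : MeasureTheory.Measure ℝ, MeasureTheory.IsFiniteMeasure ρ → (∀ ν : ℝ, 0 < ν → ∫ t in Set.Ioi (0:ℝ), Real.exp (-(ν * t)) * D.currentCorrelation μ t = ∫ ω, ν / (ν ^ 2 + ω ^ 2) ∂ρ) → (∃ L : ℝ, Filter.Tendsto (fun ε : ℝ => (ρ (Set.Icc (-ε) ε)).toReal / (2 * ε)) (nhdsWithin (0:ℝ) (Set.Ioi 0)) (nhds L)) ∨ Filter.Tendsto (fun ε : ℝ => (ρ (Set.Icc (-ε) ε)).toReal / (2 * ε)) (nhdsWithin (0:ℝ) (Set.Ioi 0)) Filter.atTop := by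
  sorry

/-- **Stub S3 — `fatouRadialPoisson`: Fatou's theorem at one point, radial form, for the Poisson integral of a
finite positive measure on the line (pure real analysis; size M).** For every finite Borel measure `ρ` on `ℝ`:
if `ρ[−ε, ε]/(2ε) → L` as `ε ↓ 0` then `∫ ν/(ν²+ω²) dρ(ω) → π·L` as `ν ↓ 0`; if `ρ[−ε, ε]/(2ε) → +∞` then
`∫ ν/(ν²+ω²) dρ(ω) → +∞`. Proof sketch (Fatou 1906; e.g. Koosis, *Introduction to `H^p` spaces*, Ch. I §D):
layer cake for the radially decreasing kernel, `∫ ν/(ν²+ω²) dρ = ∫₀^∞ K_ν(r) · (ρ[−r,r]/(2r)) dr` with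
`K_ν(r) = 4νr²/(ν²+r²)² ≥ 0`, `∫₀^∞ K_ν = π`, `K_ν(r) = ν⁻¹K₁(r/ν)` (an approximate identity at `r = 0⁺` as
`ν ↓ 0`), and the tail `∫_δ^∞ K_ν · ρ[−r,r]/(2r) ≤ ρ(ℝ)·ν/(ν²+δ²) → 0`. Calibration: `ρ = 𝟙_{[−1,1]}dω` gives
`2·arctan(1/ν) → π = π·1`. Not in Mathlib / the tree at the pin (the tree's Poisson-kernel material is for the
disc, `Literature.Analysis.Complex.DiscDirichletProblem`). -/
theorem Holds.stub_fatouRadialPoisson :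
    ∀ ρ : MeasureTheory.Measure ℝ, MeasureTheory.IsFiniteMeasure ρ → (∀ L : ℝ, Filter.Tendsto (fun ε : ℝ => (ρ (Set.Icc (-ε) ε)).toReal / (2 * ε)) (nhdsWithin (0:ℝ) (Set.Ioi 0)) (nhds L) → Filter.Tendsto (fun ν : ℝ => ∫ ω, ν / (ν ^ 2 + ω ^ 2) ∂ρ) (nhdsWithin (0:ℝ) (Set.Ioi 0)) (nhds (Real.pi * L))) ∧ (Filter.Tendsto (fun ε : ℝ => (ρ (Set.Icc (-ε) ε)).toReal / (2 * ε)) (nhdsWithin (0:ℝ) (Set.Ioi 0)) Filter.atTop → Filter.Tendsto (fun ν : ℝ => ∫ ω, ν / (ν ^ 2 + ω ^ 2) ∂ρ) (nhdsWithin (0:ℝ) (Set.Ioi 0)) Filter.atTop) := by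
  sorry

/-! ### By-name handles of the three statements (no second copy of the text) -/

/-- Statement of registered stub S1 (`Holds.stub_spectralStieltjes`), by name. -/
def stub_spectralStieltjes : Prop := type_of% Holds.stub_spectralStieltjes

/-- Statement of registered stub S2 (`Holds.stub_zeroFrequencySymmetricDerivative`), by name. -/
def stub_zeroFrequencySymmetricDerivative : Prop := type_of% Holds.stub_zeroFrequencySymmetricDerivative

/-- Statement of registered stub S3 (`Holds.stub_fatouRadialPoisson`), by name. -/
def stub_fatouRadialPoisson : Prop := type_of% Holds.stub_fatouRadialPoisson

/-! ## Part II — the skeleton theorem: the three stubs give the crux BY NAME (sorry-free) -/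

/-- **`AbelRegularity_of`** — `stub_spectralStieltjes → stub_zeroFrequencySymmetricDerivative → stub_fatouRadialPoisson →
CoercivePulse.AbelRegularity` (kernel-checked; axioms propext / Classical.choice / Quot.sound): S1 gives the
representing measure `ρ`, S2 the symmetric-derivative dichotomy for `ρ`, S3 converts each branch into the
corresponding limit of `ν ↦ ∫ ν/(ν²+ω²) dρ`, which coincides with the Abel means for `ν > 0`, i.e. eventually
along `𝓝[>] 0`. [folklore] -/
theorem AbelRegularity_of (h₁ : stub_spectralStieltjes) (h₂ : stub_zeroFrequencySymmetricDerivative)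
    (h₃ : stub_fatouRadialPoisson) :
    _root_.Summit.AtomisticToContinuum.FouriersLaw.Theses.CoercivePulse.AbelRegularity := by
  intro ω₂ lam β γ hω hl hβ T hT μ hG hSI hR D hP hSh hAC hInt
  obtain ⟨ρ, hfin, hrep⟩ := h₁ ω₂ lam β γ hω hl hβ T hT μ hG hSI hR D hP hSh hAC hInt
  have hev : ∀ᶠ ν in nhdsWithin (0:ℝ) (Set.Ioi 0),
      ∫ ω, ν / (ν ^ 2 + ω ^ 2) ∂ρ = ∫ t in Set.Ioi (0:ℝ), Real.exp (-(ν * t)) * D.currentCorrelation μ t :=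
    (eventually_mem_nhdsWithin).mono fun ν hν => (hrep ν hν).symm
  obtain ⟨hfinite, hinfinite⟩ := h₃ ρ hfin
  rcases h₂ ω₂ lam β γ hω hl hβ T hT μ hG hSI hR D hP hSh hAC hInt ρ hfin hrep with ⟨L, hL⟩ | htop
  · exact Or.inl ⟨Real.pi * L, (hfinite L hL).congr' hev⟩
  · exact Or.inr ((hinfinite htop).congr' hev)

/-- D-0027 §3.3 shape: the crux from the registered stubs (an `example`, so that `AbelRegularity_of` stays the
unique theorem concluding the crux; it becomes a proof once the three `sorry`s are discharged). -/
example : _root_.Summit.AtomisticToContinuum.FouriersLaw.Theses.CoercivePulse.AbelRegularity :=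
  AbelRegularity_of Holds.stub_spectralStieltjes Holds.stub_zeroFrequencySymmetricDerivative
    Holds.stub_fatouRadialPoisson

end Summit.AtomisticToContinuum.FouriersLaw.Cruxes.AbelRegularity.Birth

end
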